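import Literature.Computability.AlgebraicComplexity.ChowHadamardHowePullback
import Literature.Computability.AlgebraicComplexity.ChowPolarization
import Literature.Computability.AlgebraicComplexity.ChowTransposeIdentity
import Literature.Computability.AlgebraicComplexity.PlethysmLifting
import Mathlib.Analysis.Complex.Basic
import HarnessLib

/-!
# Chow reciprocity, Tier A: positivity transfer for a rational reciprocal certificate

Programme "Chow reciprocity" (Hermite–Hadamard–Howe), assembly brick A4 of the architecture
`ChowReciprocityDefs.lean` (objects `hadamardHowe` = the comorphism `h_{N,n}` of the product map,
`formSubst`, `polarize` = `ι_{n→d}`, `apolarPairing` = `⟪·,·⟫`):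

* `apolarPairing_map_int`, `apolarPairing_self_ne_zero_of_map_int` (A4.1): for an INTEGRAL polynomial
  `p₀ ≠ 0` read in a field of characteristic `0`, `⟪p₀, p₀⟫ = ∑_a a!·p_a² ≠ 0` (over `ℂ` the bilinear
  apolar pairing has isotropic vectors — the rationality hypothesis is what makes the short route work);
* `coordRingMultiplicity_chowSet_pos_of_reciprocal` (**Tier A target**): an integral highest-weight
  vector `G₀` of weight `χ` on the RECIPROCAL side `k[Sym^d k^N]_n` which does not vanish on the Chow
  variety `Ch_d(k^N)` (`h_{N,d} G ≠ 0`, Hadamard's kernel theorem `hadamardHowe_eq_zero_iff`) forces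
  `0 < mult_χ k[Ch_n(k^N)]_d` (`coordRingMultiplicity k (chowSet k N n) n χ`, DIP 2020 §5).
  Composition, as designed: `p′ := h_{N,d} G` is form-symmetric with form degrees `(n,…,n)`
  (`rename_formPerm_hadamardHowe`, `formDegree_hadamardHowe`) ⇒ `p′ = ι_{n→d} F₀` with `F₀`
  homogeneous of degree `d` (`exists_polarize_eq`) ⇒ `F₀ ∈ HWV_χ` (`mem_highestWeightSpace_of_polarize`
  with the equivariance `hadamardHowe_coordRep`) ⇒ the transpose identity
  `c·⟪h F₀, ι G⟫ = c′·⟪ι F₀, h G⟫ = c′·⟪p′, p′⟫ ≠ 0` (`transpose_identity`, integrality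
  `exists_map_eq_hadamardHowe_map`, A4.1) ⇒ `h F₀ ≠ 0` ⇒ `F₀ ∉ I(Ch_n)` ⇒
  `coordRingMultiplicity_pos_iff`.

* over `ℂ`, WITHOUT rationality (complex conjugation in the second slot of the pairing):
  `coordRingMultiplicity_chowSet_pos_of_pos_reciprocal` / `…_pos_iff_reciprocal` — **Chow reciprocity for
  occurrence**: for `|χ| = -n·d`, `0 < mult_χ ℂ[Ch_n]_d ↔ 0 < mult_χ ℂ[Ch_d]_n`.

This makes the campaign's RECIPROCAL certificate files (an explicit integral highest-weight vector on the
`Sym^d` side + a non-vanishing witness) count UNCONDITIONALLY for conjunct 2 of `DIP20_prop_5_1`, without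
the cite-fact `chowReciprocity`. Theorem-only file (no definitions, no named facts). Honest framing:
classical invariant theory (Hermite reciprocity / Hadamard–Howe duality, Landsberg 2017 §9.1) in the
service of DIP 2020's toy separation `(4,7)`; nothing here bears on VP versus VNP.

## References

* J. M. Landsberg, *Geometry and Complexity Theory*, Cambridge Studies in Advanced Mathematics 169
  (2017), §9.1.1 (Thm. 9.1.1.4, Hadamard), Ex. 9.1.2.1 (Hadamard–Howe duality). [Landsberg2017]
* J. Dörfler, C. Ikenmeyer, G. Panova, *On geometric complexity theory: multiplicity obstructions
  are stronger than occurrence obstructions*, SIAM J. Appl. Algebra Geom. 4 (2020), §5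
  ((5.3)–(5.6)). [DorflerIkenmeyerPanova2020]

Architecture: val-lit cell programme #6 (idea t15 g5, architects p7 g5 / t04 g6; bricks A1 t10 g6,
A2 t14 g6, A3 t08 g6/t10 g6, A4 this file).
-/

noncomputable section

open MvPolynomial

namespace Literature.Computability.AlgebraicComplexity

namespace ChowReciprocity

open Literature.NumberTheory.DiophantineGeometry

variable {k : Type} [Field k]


/-! ### A4.1/A4.2 — the apolar norm of an integral polynomial -/

section ApolarNorm

variable {σ : Type*}

/-- `⟪0, q⟫ = 0` for the apolar pairing. [cite: Landsberg2017, Ex. 9.1.2.1] -/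
theorem apolarPairing_zero_left (q : MvPolynomial σ k) :
    apolarPairing (0 : MvPolynomial σ k) q = 0 := by
  simp [apolarPairing]

variable [CharZero k]

/-- The apolar pairing of two INTEGRAL polynomials read in `k` is the cast of the integer
`∑_a a! · p_a q_a`. [cite: Landsberg2017, Ex. 9.1.2.1] -/
theorem apolarPairing_map_int (p₀ q₀ : MvPolynomial σ ℤ) :
    apolarPairing (MvPolynomial.map (Int.castRingHom k) p₀) (MvPolynomial.map (Int.castRingHom k) q₀) =
      ((∑ a ∈ p₀.support, ((∏ i ∈ a.support, ((a i).factorial : ℤ)) * coeff a p₀) * coeff a q₀ : ℤ) : k) := by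
  classical
  unfold apolarPairing
  rw [support_map_of_injective p₀ (RingHom.injective_int (Int.castRingHom k)), Int.cast_sum]
  refine Finset.sum_congr rfl fun a _ => ?_
  simp only [coeff_map, eq_intCast, Int.cast_mul, Int.cast_prod, Int.cast_natCast, Finsupp.prod]

/-- **A4.1** `⟪p, p⟫ ≠ 0` for a non-zero INTEGRAL polynomial read in a field of characteristic `0`:
`∑_a a! · p_a² > 0` in `ℤ` (the rationality input of the positivity transfer; false over `ℂ` for the
bilinear pairing). [cite: Landsberg2017, Ex. 9.1.2.1] -/
theorem apolarPairing_self_ne_zero_of_map_int (p₀ : MvPolynomial σ ℤ) (hp : p₀ ≠ 0) :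
    apolarPairing (MvPolynomial.map (Int.castRingHom k) p₀) (MvPolynomial.map (Int.castRingHom k) p₀)
      ≠ 0 := by
  classical
  rw [apolarPairing_map_int, Int.cast_ne_zero]
  refine (Finset.sum_pos (fun a ha => ?_) ?_).ne'
  · have hc : coeff a p₀ ≠ 0 := mem_support_iff.1 ha
    have hfac : 0 < ∏ i ∈ a.support, ((a i).factorial : ℤ) :=
      Finset.prod_pos fun i _ => by exact_mod_cast Nat.factorial_pos _
    rw [mul_assoc]
    exact mul_pos hfac (mul_self_pos.2 hc)
  · rw [Finset.nonempty_iff_ne_empty, Ne, support_eq_empty]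
    exact hp

end ApolarNorm

/-! ### A4 — the assembly -/

section Assembly

variable [CharZero k] {N n d : ℕ}

/-- **Tier A: positivity transfer for a rational reciprocal certificate.** An INTEGRAL highest-weight
vector `G₀` of weight `χ` on the `Sym^d` side, homogeneous of degree `n`, with `h_{N,d} G ≠ 0` (i.e. not
vanishing on the Chow variety `Ch_d(k^N)`), forces `0 < mult_χ k[Ch_n(k^N)]_d`. Route: form symmetry and
form degrees of `p′ = h G` (A1.4/A1.5) → `p′ = ι F₀` (A2.3) → `F₀ ∈ HWV_χ` (A2.4 with A1.3) → transpose
identity `c·⟪h F₀, ι G⟫ = c′·⟪p′, p′⟫` (A3) → `≠ 0` by integrality (A1.6, A4.1) → Hadamard's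
kernel theorem (A1.2) and `coordRingMultiplicity_pos_iff`.
[cite: Landsberg2017, §9.1.1 Thm. 9.1.1.4 and Ex. 9.1.2.1] [cite: DorflerIkenmeyerPanova2020, §5 (5.3)–(5.6)] -/
theorem coordRingMultiplicity_chowSet_pos_of_reciprocal (hn : n ≠ 0) (χ : Weight (Fin N))
    (G₀ : MvPolynomial (DegIdx (Fin N) d) ℤ) (hG₀ : G₀.IsHomogeneous n)
    (hG : MvPolynomial.map (Int.castRingHom k) G₀ ∈ highestWeightSpace (coordRep (Fin N) k d) χ)
    (hne : hadamardHowe N d (MvPolynomial.map (Int.castRingHom k) G₀) ≠ 0) :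
    0 < coordRingMultiplicity k (chowSet k N n) n χ := by
  classical
  haveI : Infinite k := CharZero.infinite k
  set G := MvPolynomial.map (Int.castRingHom k) G₀ with hGdef
  have hGhom : G.IsHomogeneous n := hG₀.map _
  set p' := hadamardHowe N d G with hp'
  -- p′ is form-symmetric of form degree n (A1.4, A1.5 at (N, d, G)), hence polarised from some `F₀`
  obtain ⟨F₀, hF₀, hιF₀⟩ := exists_polarize_eq (k := k) (N := N) (n := n) (d := d) p'
    (fun π => by rw [hp']; exact rename_formPerm_hadamardHowe N d π G)
    (fun a ha kk => formDegree_hadamardHowe N d hGhom (by rwa [hp'] at ha) kk)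
  -- F₀ is a highest-weight vector of weight χ (A2.4 with A1.3)
  have hF₀χ : F₀ ∈ highestWeightSpace (coordRep (Fin N) k n) χ := by
    refine mem_highestWeightSpace_of_polarize χ hF₀ fun g hg => ?_
    rw [hιF₀, hp', ← hadamardHowe_coordRep, (mem_highestWeightSpace_iff _ _ _).1 hG g hg, map_smul]
  -- the transpose identity at (F₀, G): c · ⟪h F₀, ι G⟫ = c′ · ⟪p′, p′⟫ ≠ 0
  have hid := transpose_identity (k := k) hF₀ hGhom
  rw [hιF₀] at hid
  obtain ⟨p₀, hp₀⟩ := exists_map_eq_hadamardHowe_map (k := k) N d G₀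
  have hp'int : p' = MvPolynomial.map (Int.castRingHom k) p₀ := by rw [hp', hGdef, hp₀]
  have hp₀0 : p₀ ≠ 0 := by
    intro h0
    apply hne
    rw [hp'int, h0, map_zero]
  have hnorm : apolarPairing p' p' ≠ 0 := by
    rw [hp'int]; exact apolarPairing_self_ne_zero_of_map_int _ hp₀0
  have hc : ((d.factorial : k) ^ n * n.factorial) ≠ 0 :=
    mul_ne_zero (pow_ne_zero _ (by exact_mod_cast d.factorial_ne_zero))
      (by exact_mod_cast n.factorial_ne_zero)
  have hhF₀ : hadamardHowe N n F₀ ≠ 0 := by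
    intro h0
    rw [h0, apolarPairing_zero_left, mul_zero, ← hp'] at hid
    exact (mul_ne_zero hc hnorm) hid.symm
  -- conclude
  rw [coordRingMultiplicity_pos_iff hn]
  exact ⟨F₀, hF₀χ, fun hI => hhF₀ ((hadamardHowe_eq_zero_iff N n F₀).2 hI)⟩

/-- **The same from an evaluation witness** (the shape the campaign's reciprocal certificate files
emit: an integral highest-weight vector `G₀` on the `Sym^d` side, an INTEGER Chow point
`ℓ_{a_0} ⋯ ℓ_{a_{d-1}}` and a non-zero value of `G₀` there): then `h_{N,d} G ≠ 0` by `eval_hadamardHowe`,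
and `coordRingMultiplicity_chowSet_pos_of_reciprocal` applies.
[cite: DorflerIkenmeyerPanova2020, §5 (5.6)] [cite: Landsberg2017, §9.1.1 Thm. 9.1.1.4] -/
theorem coordRingMultiplicity_chowSet_pos_of_aeval_ne_zero (hn : n ≠ 0) (χ : Weight (Fin N))
    (G₀ : MvPolynomial (DegIdx (Fin N) d) ℤ) (hG₀ : G₀.IsHomogeneous n)
    (hG : MvPolynomial.map (Int.castRingHom k) G₀ ∈ highestWeightSpace (coordRep (Fin N) k d) χ)
    (a : Fin d → Fin N → ℤ)
    (ha : aeval (formCoeff d (∏ l : Fin d, linearForm fun i : Fin N => (a l i : k)))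
      (MvPolynomial.map (Int.castRingHom k) G₀) ≠ 0) :
    0 < coordRingMultiplicity k (chowSet k N n) n χ := by
  refine coordRingMultiplicity_chowSet_pos_of_reciprocal hn χ G₀ hG₀ hG fun h0 => ha ?_
  have h := eval_hadamardHowe N d (fun li : Fin d × Fin N => (a li.1 li.2 : k))
    (MvPolynomial.map (Int.castRingHom k) G₀)
  rw [h0, map_zero] at h
  exact h.symm

end Assembly

/-! ### Over `ℂ`: positivity transfer without rationality (complex conjugation) -/

section Complex

variable {σ : Type*}

/-- `⟪p, p̄⟫ = ∑_a a!·|p_a|² ≠ 0` for a non-zero complex polynomial (conjugating the coefficients of the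
second argument makes the apolar pairing positive definite). [cite: Landsberg2017, Ex. 9.1.2.1] -/
theorem apolarPairing_self_map_conj_ne_zero (p : MvPolynomial σ ℂ) (hp : p ≠ 0) :
    apolarPairing p (MvPolynomial.map (starRingEnd ℂ) p) ≠ 0 := by
  classical
  unfold apolarPairing
  have hterm : ∀ a : σ →₀ ℕ, ((a.prod fun _ m => (m.factorial : ℂ)) * coeff a p) *
      coeff a (MvPolynomial.map (starRingEnd ℂ) p) =
      (((∏ i ∈ a.support, ((a i).factorial : ℝ)) * Complex.normSq (coeff a p) : ℝ) : ℂ) := by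
    intro a
    rw [coeff_map, mul_assoc, Complex.mul_conj, Finsupp.prod]
    push_cast
    rfl
  simp_rw [hterm]
  rw [← Complex.ofReal_sum, Complex.ofReal_ne_zero]
  refine (Finset.sum_pos (fun a ha => ?_) ?_).ne'
  · have hc : coeff a p ≠ 0 := mem_support_iff.1 ha
    exact mul_pos (Finset.prod_pos fun i _ => by exact_mod_cast Nat.factorial_pos _)
      (Complex.normSq_pos.2 hc)
  · rw [Finset.nonempty_iff_ne_empty, Ne, support_eq_empty]
    exact hp

variable {N n d : ℕ}

/-- `h` commutes with complex conjugation of the coefficients (its structure constants are integers;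
`hadamardHowe_map` at `φ = conj`). [cite: Landsberg2017, §9.1.1 (Def. 9.1.1.1)] -/
theorem hadamardHowe_map_conj (G : MvPolynomial (DegIdx (Fin N) d) ℂ) :
    hadamardHowe N d (MvPolynomial.map (starRingEnd ℂ) G) =
      MvPolynomial.map (starRingEnd ℂ) (hadamardHowe N d G) :=
  hadamardHowe_map N d (starRingEnd ℂ) G

/-- **Positivity transfer over `ℂ` (half of Chow reciprocity as an inequality).** For `n, d ≥ 1` and a
weight `χ` with `|χ| = -n·d`: if `χ` occurs in `ℂ[Ch_d(ℂ^N)]_n` then it occurs in `ℂ[Ch_n(ℂ^N)]_d`.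
Route: a highest-weight vector `G ∉ I(Ch_d)` (`coordRingMultiplicity_pos_iff`) has `p′ := h_{N,d} G ≠ 0`
(Hadamard), `p′ = ι F₀` with `F₀ ∈ HWV_χ` (A1.4/A1.5/A2.3/A2.4/A1.3), and the transpose identity at
`(F₀, Ḡ)` gives `c·⟪h F₀, ι Ḡ⟫ = c′·⟪p′, p̄′⟫ ≠ 0`, so `h F₀ ≠ 0` and `F₀ ∉ I(Ch_n)`. The conjugation
replaces the rationality hypothesis of `coordRingMultiplicity_chowSet_pos_of_reciprocal` (idea: the
programme's Tier-B design line, t04 g6).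
[cite: Landsberg2017, §9.1.1 Thm. 9.1.1.4 and Ex. 9.1.2.1] [cite: DorflerIkenmeyerPanova2020, §5 (5.3)–(5.6)] -/
theorem coordRingMultiplicity_chowSet_pos_of_pos_reciprocal (hn : n ≠ 0) (hd : d ≠ 0)
    (χ : Weight (Fin N)) (hχ : (∑ i, χ i) = -((n * d : ℕ) : ℤ))
    (h : 0 < coordRingMultiplicity ℂ (chowSet ℂ N d) d χ) :
    0 < coordRingMultiplicity ℂ (chowSet ℂ N n) n χ := by
  classical
  obtain ⟨G, hG, hGI⟩ := (coordRingMultiplicity_pos_iff hd χ).1 h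
  have hχ' : χ.size = -((d * n : ℕ) : ℤ) := by rw [Weight.size, hχ, Nat.mul_comm]
  have hGhom : G.IsHomogeneous n := isHomogeneous_of_mem_highestWeightSpace hd hG hχ'
  set p' := hadamardHowe N d G with hp'
  have hne : p' ≠ 0 := fun h0 => hGI ((hadamardHowe_eq_zero_iff N d G).1 h0)
  obtain ⟨F₀, hF₀, hιF₀⟩ := exists_polarize_eq (k := ℂ) (N := N) (n := n) (d := d) p'
    (fun π => by rw [hp']; exact rename_formPerm_hadamardHowe N d π G)
    (fun a ha kk => formDegree_hadamardHowe N d hGhom (by rwa [hp'] at ha) kk)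
  have hF₀χ : F₀ ∈ highestWeightSpace (coordRep (Fin N) ℂ n) χ := by
    refine mem_highestWeightSpace_of_polarize χ hF₀ fun g hg => ?_
    rw [hιF₀, hp', ← hadamardHowe_coordRep, (mem_highestWeightSpace_iff _ _ _).1 hG g hg, map_smul]
  -- transpose identity at (F₀, conj G)
  have hid := transpose_identity (k := ℂ) hF₀ (hGhom.map (starRingEnd ℂ))
  rw [hadamardHowe_map_conj, ← hp'] at hid
  have hnorm : apolarPairing p' (MvPolynomial.map (starRingEnd ℂ) p') ≠ 0 :=
    apolarPairing_self_map_conj_ne_zero p' hne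
  have hc : ((d.factorial : ℂ) ^ n * n.factorial) ≠ 0 :=
    mul_ne_zero (pow_ne_zero _ (by exact_mod_cast d.factorial_ne_zero))
      (by exact_mod_cast n.factorial_ne_zero)
  have hhF₀ : hadamardHowe N n F₀ ≠ 0 := by
    intro h0
    rw [h0, apolarPairing_zero_left, mul_zero, hιF₀] at hid
    exact (mul_ne_zero hc hnorm) hid.symm
  rw [coordRingMultiplicity_pos_iff hn]
  exact ⟨F₀, hF₀χ, fun hI => hhF₀ ((hadamardHowe_eq_zero_iff N n F₀).2 hI)⟩

/-- **Chow reciprocity for OCCURRENCE** (positivity form of `chowReciprocity`, unconditional): for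
`n, d ≥ 1` and `|χ| = -n·d`, `χ` occurs in `ℂ[Ch_n(ℂ^N)]_d` iff it occurs in `ℂ[Ch_d(ℂ^N)]_n` — what
conjunct 2 of `DIP20_prop_5_1` consumes from a reciprocal certificate.
[cite: Landsberg2017, Ex. 9.1.2.1 (h_{d,n}^T = h_{n,d})] [cite: DorflerIkenmeyerPanova2020, Prop. 5.1] -/
theorem coordRingMultiplicity_chowSet_pos_iff_reciprocal (hn : n ≠ 0) (hd : d ≠ 0)
    (χ : Weight (Fin N)) (hχ : (∑ i, χ i) = -((n * d : ℕ) : ℤ)) :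
    0 < coordRingMultiplicity ℂ (chowSet ℂ N n) n χ ↔ 0 < coordRingMultiplicity ℂ (chowSet ℂ N d) d χ :=
  ⟨coordRingMultiplicity_chowSet_pos_of_pos_reciprocal hd hn χ (by rw [hχ, Nat.mul_comm]),
    coordRingMultiplicity_chowSet_pos_of_pos_reciprocal hn hd χ hχ⟩

end Complex



end ChowReciprocity

end Literature.Computability.AlgebraicComplexity

end
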